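import Literature.Algebra.Homology.OrderedCechPairSystem
import Mathlib.Algebra.Homology.TotalComplexSymmetry
import HarnessLib

/-!
# The ordered Čech bicomplex of a pair-system is symmetric under exchanging the two index sets (Stacks 0BEC, 012K)

Layer `Literature/Algebra/Homology` (constructions + proved lemmas; 0 named facts, no instance, no notation; pure homological
algebra over a commutative ring `A`). Sequel to `Algebra/Homology/OrderedCechPairSystem`: for a pair-system
`P : Finset ι ⥤ Finset κ ⥤ ModuleCat A` with ordered Čech bicomplex `Č•,•(P) = sysBicomplex P` (`Čᵃ,ᵇ(P) = Π_τ Π_σ P σ τ`, outer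
index the `σ`-degree `a`), the FLIPPED pair-system `P.flip : Finset κ ⥤ Finset ι ⥤ ModuleCat A` (`(t, s) ↦ P s t`) has
`Čᵇ,ᵃ(P.flip) = Π_σ Π_τ P σ τ`, and exchanging the order of the two finite products identifies its bicomplex with Mathlib's flip
(`HomologicalComplex₂.flip`, rows ↔ columns) of `Č•,•(P)`:

* `ext0At_cochainSystem_apply` — evaluating the zero-extension of a cochain of the `κ`-system `cochainSystem P a` at a simplex
  `σ` is the zero-extension of its `σ`-slice in the `κ`-system `P σ`;
* `flipCochainEquiv P a b : Čᵃ(cochainSystem P.flip b) ≃ₗ[A] Čᵇ(cochainSystem P a)`, `y ↦ ((τ, σ) ↦ y σ τ)`;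
* **`sysBicomplexFlipIso P : sysBicomplex P.flip ≅ (sysBicomplex P).flip`** (both differentials match: the `σ`-differential of
  `P.flip`'s bicomplex is the inner one, `sysD_apply` on both sides), `sysBicomplexFlipIso_hom_f_f_apply` (`rfl`);
* **`sysBicomplexFlipTotalIso P : Tot Č•,•(P.flip) ≅ Tot Č•,•(P)`** — through Mathlib's `HomologicalComplex₂.totalFlipIso` (the signs
  `(-1)^{ab}` are Mathlib's `TotalComplexShapeSymmetry` instance on `up ℤ`, not re-derived here).

With it every «columns» statement about `Č•,•` (`Algebra/Homology/OrderedCechPairSystemBounds`, `TotalQuasiIsoOfBoundedColumns`)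
has its «rows» form for pair-systems. Library only (cell `pub-hodge-ring2`, count-neutral); proves nothing about any crux, route or
conjecture. Mathlib searched (pin v4.32): `HomologicalComplex₂.flip` (+ `flip_X_X` / `flip_X_d` / `flip_d_f`), `totalFlipIso`,
`HomologicalComplex.Hom.isoOfComponents`, `LinearEquiv.toModuleIso`, `Functor.flip` (used); `LinearEquiv.piComm` exists but the
cochain modules are type synonyms, so the swap is written out.

## References

* The Stacks Project, Tag 0BEC (Künneth: the double Čech complex), Tag 012K (double complexes; transposition), Tag 01FG. [StacksProject]
* U. Görtz, T. Wedhorn, *Algebraic Geometry II* (2023), Def. 21.68 (p. 180). [GortzWedhorn2023]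
-/

universe u

open CategoryTheory

set_option backward.isDefEq.respectTransparency false

noncomputable section

namespace Literature.Algebra.Homology

namespace OrderedCech

variable {A : Type u} [CommRing A] {ι κ : Type} [LinearOrder ι] [LinearOrder κ]
  (P : Finset ι ⥤ Finset κ ⥤ ModuleCat.{u} A)

/-! ### §1 Slices of cochains of `cochainSystem P a` -/

variable {P} in
/-- **Zero-extension commutes with evaluation at a simplex**: for a `κ`-cochain `y` of the system `t ↦ Čᵃ(P(·, t))` and an
`a`-simplex `σ` of `ι`, `(y.ext0At s t)_σ` is the zero-extension, in the `κ`-system `P σ`, of the slice `τ ↦ (y τ)_σ`.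
[cite: GortzWedhorn2023, Def. 21.68 (p. 180)] -/
theorem ext0At_cochainSystem_apply {a b : ℤ} (y : SysCochain (cochainSystem P a) b) (s t : Finset κ) (σ : Simplex ι a) :
    (y.ext0At s t : SysCochain (P.flip.obj t) a) σ =
      SysCochain.ext0At (M := P.obj σ.1) (fun τ : Simplex κ b => (y τ : SysCochain (P.flip.obj τ.1) a) σ) s t := by
  unfold SysCochain.ext0At
  split_ifs <;> rfl

/-! ### §2 The swap of the two finite products and the isomorphism of bicomplexes -/

/-- **`Čᵃ(cochainSystem P.flip b) ≃ₗ[A] Čᵇ(cochainSystem P a)`**, `y ↦ ((τ, σ) ↦ y σ τ)`: exchanging the order of the two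
finite products `Π_σ Π_τ P σ τ ≃ Π_τ Π_σ P σ τ`. [cite: StacksProject, Tag 012K] -/
def flipCochainEquiv (a b : ℤ) : SysCochain (cochainSystem P.flip b) a ≃ₗ[A] SysCochain (cochainSystem P a) b where
  toFun y := fun τ σ => (y σ : SysCochain (P.flip.flip.obj σ.1) b) τ
  invFun x := fun σ τ => (x τ : SysCochain (P.flip.obj τ.1) a) σ
  map_add' _ _ := rfl
  map_smul' _ _ := rfl
  left_inv _ := rfl
  right_inv _ := rfl

/-- The swap on elements (`rfl`). [cite: StacksProject, Tag 012K] -/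
@[simp] theorem flipCochainEquiv_apply (a b : ℤ) (y : SysCochain (cochainSystem P.flip b) a) (τ : Simplex κ b)
    (σ : Simplex ι a) :
    (flipCochainEquiv P a b y : SysCochain (cochainSystem P a) b) τ σ = (y σ : SysCochain (P.flip.flip.obj σ.1) b) τ := rfl

/-- **`Č•,•(P.flip) ≅ flip Č•,•(P)`**: the ordered Čech bicomplex of the flipped pair-system is the transpose of the ordered Čech
bicomplex (termwise `flipCochainEquiv`; the `σ`-Čech differential is the inner differential on the left and the transposed outer
differential on the right, the `τ`-differential the other way round — `sysD_apply` and `ext0At_cochainSystem_apply` on both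
sides). [cite: StacksProject, Tag 0BEC] [cite: StacksProject, Tag 012K] -/
def sysBicomplexFlipIso : sysBicomplex P.flip ≅ (sysBicomplex P).flip :=
  HomologicalComplex.Hom.isoOfComponents
    (fun b => HomologicalComplex.Hom.isoOfComponents (fun a => (flipCochainEquiv P a b).toModuleIso)
      (fun a a' haa' => by
        subst haa'
        apply ModuleCat.hom_ext
        apply LinearMap.ext
        intro y
        rw [ModuleCat.hom_comp, ModuleCat.hom_comp, LinearMap.comp_apply, LinearMap.comp_apply]
        erw [HomologicalComplex₂.flip_X_d, sysBicomplex_d_f_apply, sysBicomplex_X_d_apply]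
        change sysCochainMap (cochainSystemD P a) b (flipCochainEquiv P a b y) =
          flipCochainEquiv P (a + 1) b (sysD (cochainSystem P.flip b) a y)
        funext τ σ'
        rw [sysCochainMap_apply, cochainSystemD_app_apply, sysD_apply, flipCochainEquiv_apply, sysD_apply,
          Finset.sum_apply]
        refine Finset.sum_congr rfl fun i _ => ?_
        rw [Pi.smul_apply, ext0At_cochainSystem_apply]
        rfl))
    (fun b b' hbb' => by
      subst hbb'
      refine HomologicalComplex.hom_ext _ _ fun a => ?_
      apply ModuleCat.hom_ext
      apply LinearMap.ext
      intro y
      rw [HomologicalComplex.comp_f, HomologicalComplex.comp_f, ModuleCat.hom_comp, ModuleCat.hom_comp,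
        LinearMap.comp_apply, LinearMap.comp_apply]
      erw [HomologicalComplex₂.flip_d_f, sysBicomplex_X_d_apply, sysBicomplex_d_f_apply]
      change sysD (cochainSystem P a) b (flipCochainEquiv P a b y) =
        flipCochainEquiv P a (b + 1) (sysCochainMap (cochainSystemD P.flip b) a y)
      funext τ' σ
      rw [sysD_apply, Finset.sum_apply, flipCochainEquiv_apply, sysCochainMap_apply, cochainSystemD_app_apply,
        sysD_apply]
      refine Finset.sum_congr rfl fun j _ => ?_
      rw [Pi.smul_apply, ext0At_cochainSystem_apply]
      rfl)

/-- The components of `sysBicomplexFlipIso` on elements: the swap (`rfl`). [cite: StacksProject, Tag 012K] -/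
@[simp] theorem sysBicomplexFlipIso_hom_f_f_apply (b a : ℤ) (y : SysCochain (cochainSystem P.flip b) a) (τ : Simplex κ b)
    (σ : Simplex ι a) :
    ((((sysBicomplexFlipIso P).hom.f b).f a).hom y : SysCochain (cochainSystem P a) b) τ σ =
      (y σ : SysCochain (P.flip.flip.obj σ.1) b) τ := rfl

/-- The components of the inverse of `sysBicomplexFlipIso` on elements (`rfl`). [cite: StacksProject, Tag 012K] -/
@[simp] theorem sysBicomplexFlipIso_inv_f_f_apply (b a : ℤ) (x : SysCochain (cochainSystem P a) b) (σ : Simplex ι a)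
    (τ : Simplex κ b) :
    ((((sysBicomplexFlipIso P).inv.f b).f a).hom x : SysCochain (cochainSystem P.flip b) a) σ τ =
      (x τ : SysCochain (P.flip.obj τ.1) a) σ := rfl

/-! ### §3 The total complexes -/

/-- **`Tot Č•,•(P.flip) ≅ Tot Č•,•(P)`**: total complexes do not see the transposition (Mathlib's `totalFlipIso`, with its signs
`(-1)^{ab}` on the summands, composed with `Tot` of `sysBicomplexFlipIso`). [cite: StacksProject, Tag 012K] [cite: StacksProject, Tag 0BEC] -/
def sysBicomplexFlipTotalIso :
    (sysBicomplex P.flip).total (ComplexShape.up ℤ) ≅ (sysBicomplex P).total (ComplexShape.up ℤ) :=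
  HomologicalComplex₂.total.mapIso (sysBicomplexFlipIso P) (ComplexShape.up ℤ) ≪≫
    (sysBicomplex P).totalFlipIso (ComplexShape.up ℤ)

end OrderedCech

end Literature.Algebra.Homology

end
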